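import Literature.Geometry.Riemannian.LipschitzSmoothing
import HarnessLib

/-!
# Smooth approximation of compactly supported Lipschitz functions with gradient control on
# non-compact manifolds (Azagra–Ferrera–López-Mesas–Rangel 2007, Thm. 1, compact-support case)

Sequel of `LipschitzSmoothing.lean` (which treats CLOSED manifolds) for the proof programme of
`Literature.Geometry.Riemannian.Carron1998_ends_le_rank_l2HarmonicOneForms`: the test functions
fed into a Sobolev inequality `(S_p)` — stated for `C_c^∞` functions — to extract the volume lower
bound `vol B(x, r) ≥ C(p) (μ r²)^{p/2}` (G. Carron, arXiv:0704.3194 (2007), proof of Prop. 2.11,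
citing Carron 1996, Prop. 2.4; Akutagawa 1994; the cutoffs `(1 - d(x, ·)/r)₊` "by approximation")
are compactly supported Lipschitz functions of the distance on a COMPLETE, NON-COMPACT manifold.
For a smooth Riemannian metric `g` (a Riemannian `PseudoRiemannianMetric`, boundaryless model on
a finite-dimensional space) on a Hausdorff σ-compact manifold `M` and a continuous compactly
supported `F : M → ℝ` with `|F x - F y| ≤ L d_g(x, y)` (in `ℝ≥0∞`), we PROVE

* `exists_contDiff_chart_smoothing_of_bounded` — the chart-local mollification with sharp
  gradient control of `LipschitzSmoothing.exists_contDiff_chart_smoothing`, with the hypothesis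
  `[CompactSpace M]` (used there only to bound `F`) replaced by boundedness of `F` (proof verbatim);
* `exists_contMDiff_approx_of_hasCompactSupport` — **for every `ε > 0` and open `W ⊇ tsupport F`
  there is a `C^∞` function `χ` with compact support inside `W`, `|χ - F| < ε` and
  `|∇χ|²_g ≤ (L + ε)²` everywhere** (Azagra–Ferrera–López-Mesas–Rangel, J. Math. Anal. Appl. 326
  (2007), Thm. 1: "`|f - g| ≤ ε`, `Lip(g) ≤ Lip(f) + r`", here for compactly supported `f`, by
  the gluing argument of the compact case over a FINITE cover: finitely many relatively compact
  chart domains covering `tsupport F` plus the open set `(tsupport F)ᶜ`, on which the local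
  approximation is `0`).

Everything is proved; no definitions, no named facts (D-0026).

## References

* D. Azagra, J. Ferrera, F. López-Mesas, Y. Rangel, *Smooth approximation of Lipschitz functions
  on Riemannian manifolds*, J. Math. Anal. Appl. 326 (2007), 1370–1378, Thm. 1. [`AzagraEtAl2007`]
* G. Carron, *L² harmonic forms on non-compact Riemannian manifolds*, arXiv:0704.3194 (2007),
  proof of Prop. 2.11. [`Carron2007`]
-/

noncomputable section

open Bundle Set Function Filter Manifold MeasureTheory Metric
open scoped Manifold ContDiff Topology ENNReal NNReal Convolution

namespace Literature.Geometry.Riemannian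

open Lorentzian

/-! ### The chart-local smoothing for bounded `F` -/

section ChartToManifold

variable {E : Type*} [NormedAddCommGroup E] [NormedSpace ℝ E] [FiniteDimensional ℝ E]
  {H : Type*} [TopologicalSpace H] {I : ModelWithCorners ℝ E H} [I.Boundaryless]
  {M : Type*} [TopologicalSpace M] [ChartedSpace H M] [IsManifold I ∞ M]
  (g : PseudoRiemannianMetric I ∞ E (TangentSpace I : M → Type _))

/-- **Chart-local smoothing of a bounded Lipschitz function with sharp gradient control**
(`LipschitzSmoothing.exists_contDiff_chart_smoothing` with `[CompactSpace M]` weakened to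
boundedness of `F`; the proof is the same mollification `ψ_R ⋆ (F ∘ φ⁻¹)` at a small scale).
Let `g` be Riemannian, `F : M → ℝ` continuous and bounded with `|F x - F y| ≤ L d_g(x, y)`,
`φ = extChartAt I x₀`, `K` a compact subset of the chart domain and `η₁, η₂ > 0`. Then there is a
smooth `Φ : E → ℝ` with `|Φ(φ x) - F x| ≤ η₁` and `|d(Φ ∘ φ)_x u| ≤ L (1 + η₂) |u|_g` for `x ∈ K`.
[cite: AzagraEtAl2007, Thm. 1 (proof, finite-dimensional case)] -/
theorem exists_contDiff_chart_smoothing_of_bounded (hg : g.IsRiemannian) (x₀ : M)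
    {F : M → ℝ} (hFc : Continuous F) (hFb : ∃ C, ∀ x, ‖F x‖ ≤ C) {L : ℝ} (hL : 0 ≤ L)
    (hF : ∀ x y, ENNReal.ofReal |F x - F y| ≤ ENNReal.ofReal L * g.edist hg x y)
    {K : Set M} (hK : IsCompact K) (hKs : K ⊆ (chartAt H x₀).source) {η₁ η₂ : ℝ}
    (hη₁ : 0 < η₁) (hη₂ : 0 < η₂) :
    ∃ Φ : E → ℝ, ContDiff ℝ ∞ Φ ∧ (∀ x ∈ K, |Φ (extChartAt I x₀ x) - F x| ≤ η₁) ∧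
      ∀ x ∈ K, ∀ u : TangentSpace I x,
        |mvfderiv I (Φ ∘ extChartAt I x₀) x u| ≤ L * (1 + η₂) * Real.sqrt (g.val x u u) := by
  classical
  letI : MeasurableSpace E := borel E
  haveI : BorelSpace E := ⟨rfl⟩
  set μ : Measure E := Measure.addHaar with hμ
  set φ := extChartAt I x₀ with hφ
  have hKs' : K ⊆ φ.source := by rwa [hφ, extChartAt_source]
  -- the compact image of `K` in the chart and a compact cthickening inside the target
  set Kc : Set E := φ '' K with hKc
  have hKcc : IsCompact Kc := hK.image_of_continuousOn ((continuousOn_extChartAt x₀).mono hKs')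
  have hKct : Kc ⊆ φ.target := by
    rintro _ ⟨x, hx, rfl⟩; exact φ.map_source (hKs' hx)
  obtain ⟨r, hr, hrK⟩ := hKcc.exists_cthickening_subset_open (isOpen_extChartAt_target x₀) hKct
  set K' : Set E := cthickening r Kc with hK'
  have hK'c : IsCompact K' := hKcc.cthickening
  -- (i) comparison of the pulled-back metrics near `Kc`
  obtain ⟨ε₁, hε₁, hcomp⟩ := exists_forall_val_mfderivWithin_symm_le g hg x₀ hKcc hKct hη₂
  -- (ii) uniform continuity of `F ∘ φ⁻¹` on `K'`
  have hFsc : ContinuousOn (F ∘ φ.symm) K' :=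
    (hFc.comp_continuousOn (continuousOn_extChartAt_symm x₀)).mono hrK
  obtain ⟨δ₁, hδ₁, hUC⟩ := Metric.uniformContinuousOn_iff.1
    (hK'c.uniformContinuousOn_of_continuous hFsc) η₁ hη₁
  -- the smoothing scale and the bump
  set R : ℝ := min (ε₁ / 2) (min r δ₁) / 2 with hR
  have hRpos : 0 < R := by positivity
  have hRε : 2 * R ≤ ε₁ / 2 := by
    have : min (ε₁ / 2) (min r δ₁) ≤ ε₁ / 2 := min_le_left _ _
    rw [hR]; linarith
  have hRr : R ≤ r / 2 := by
    have : min (ε₁ / 2) (min r δ₁) ≤ r := (min_le_right _ _).trans (min_le_left _ _)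
    rw [hR]; linarith
  have hRδ : R ≤ δ₁ / 2 := by
    have : min (ε₁ / 2) (min r δ₁) ≤ δ₁ := (min_le_right _ _).trans (min_le_right _ _)
    rw [hR]; linarith
  let ψ : ContDiffBump (0 : E) := ⟨R / 2, R, by positivity, by linarith⟩
  have hψR : ψ.rOut = R := rfl
  -- the representative `Ĝ = 𝟙_target · F ∘ φ⁻¹`, bounded and measurable, hence locally integrable
  set Ĝ : E → ℝ := φ.target.indicator (F ∘ φ.symm) with hĜdef
  have hĜ : ∀ a ∈ φ.target, Ĝ a = F (φ.symm a) := fun a ha ↦ by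
    simp [hĜdef, indicator_of_mem ha]
  obtain ⟨CF, hCF⟩ := hFb
  have hĜb : ∀ a, ‖Ĝ a‖ ≤ max CF 0 := by
    intro a
    by_cases ha : a ∈ φ.target
    · rw [hĜ a ha]; exact (hCF _).trans (le_max_left _ _)
    · simp [hĜdef, indicator_of_notMem ha]
  have hĜm : AEStronglyMeasurable Ĝ μ := by
    rw [hĜdef, aestronglyMeasurable_indicator_iff (isOpen_extChartAt_target x₀).measurableSet]
    exact (hFc.comp_continuousOn (continuousOn_extChartAt_symm x₀)).aestronglyMeasurable
      (isOpen_extChartAt_target x₀).measurableSet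
  have hĜi : LocallyIntegrable Ĝ μ := by
    refine (locallyIntegrable_iff).2 (fun C hC ↦ ?_)
    exact Measure.integrableOn_of_bounded hC.measure_lt_top.ne hĜm
      (Eventually.of_forall fun a ↦ hĜb a)
  -- the mollification
  set Φ : E → ℝ := ψ.normed μ ⋆[ContinuousLinearMap.lsmul ℝ ℝ, μ] Ĝ with hΦ
  have hΦs : ContDiff ℝ ∞ Φ :=
    ψ.hasCompactSupport_normed.contDiff_convolution_left _ ψ.contDiff_normed hĜi
  refine ⟨Φ, hΦs, fun x hx ↦ ?_, fun x hx u ↦ ?_⟩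
  · -- closeness: `|Φ(φ x) - F x| ≤ η₁` by uniform continuity at scale `R ≤ δ₁/2`
    have hy : φ x ∈ Kc := mem_image_of_mem _ hx
    have hyK' : φ x ∈ K' := self_subset_cthickening _ hy
    have hclose : ∀ y' ∈ ball (φ x) ψ.rOut, dist (Ĝ y') (Ĝ (φ x)) ≤ η₁ := by
      intro y' hy'
      rw [hψR] at hy'
      have hy'K' : y' ∈ K' := closedBall_subset_cthickening hy r
        (mem_closedBall.2 (by rw [mem_ball] at hy'; linarith))
      rw [hĜ y' (hrK hy'K'), hĜ _ (hrK hyK')]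
      refine (hUC y' hy'K' (φ x) hyK' ?_).le
      rw [mem_ball] at hy'; linarith
    have h := ContDiffBump.dist_normed_convolution_le (φ := ψ) (μ := μ) hĜm hclose
    rw [Real.dist_eq, hĜ _ (hrK hyK'), show φ.symm (φ x) = x from φ.left_inv (hKs' hx)] at h
    exact h
  · -- the differential: `abs_fderiv_mollify_le` with `S² = (1 + η₂) g(D(φ⁻¹) w, D(φ⁻¹) w)`
    have hy : φ x ∈ Kc := mem_image_of_mem _ hx
    have hball : ball (φ x) (2 * ψ.rOut) ⊆ φ.target := by
      intro a ha
      rw [hψR, mem_ball, dist_eq_norm] at ha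
      exact (hcomp (φ x) hy a (by linarith)).1
    refine abs_mvfderiv_comp_extChartAt_le g x₀ (hKs hx)
      ((hΦs.differentiable (by simp)) _) (fun w ↦ ?_) u
    set P₀ : ℝ := g.val (φ.symm (φ x))
      (mfderivWithin 𝓘(ℝ, E) I φ.symm (range I) (φ x) w)
      (mfderivWithin 𝓘(ℝ, E) I φ.symm (range I) (φ x) w) with hP₀
    have hP₀nn : 0 ≤ P₀ := by
      rw [hP₀]
      by_cases h0 : mfderivWithin 𝓘(ℝ, E) I φ.symm (range I) (φ x) w = 0
      · rw [h0]; simp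
      · exact (hg _ _ h0).le
    set S : ℝ := Real.sqrt ((1 + η₂) * P₀) with hS
    have hSw : ∀ a ∈ ball (φ x) (2 * ψ.rOut), g.val (φ.symm a)
        (mfderivWithin 𝓘(ℝ, E) I φ.symm (range I) a w)
        (mfderivWithin 𝓘(ℝ, E) I φ.symm (range I) a w) ≤ S ^ 2 := by
      intro a ha
      rw [hψR, mem_ball, dist_eq_norm] at ha
      rw [hS, Real.sq_sqrt (by positivity)]
      exact (hcomp (φ x) hy a (by linarith)).2 w
    have hmain := abs_fderiv_mollify_le g hg x₀ hL hF ψ hĜi hĜ (Real.sqrt_nonneg _) hball hSw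
    refine hmain.trans ?_
    -- `L √((1+η₂) P₀) ≤ L (1+η₂) √P₀`
    rw [Real.sqrt_mul (by positivity), mul_assoc]
    gcongr
    rw [Real.sqrt_le_iff]
    exact ⟨by positivity, by nlinarith⟩


end ChartToManifold

/-! ### Global smoothing of a compactly supported Lipschitz function -/

section Global

variable {E : Type*} [NormedAddCommGroup E] [NormedSpace ℝ E] [FiniteDimensional ℝ E]
  {H : Type*} [TopologicalSpace H] {I : ModelWithCorners ℝ E H} [I.Boundaryless]
  {M : Type*} [TopologicalSpace M] [T2Space M] [SigmaCompactSpace M] [ChartedSpace H M]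
  [IsManifold I ∞ M]
  (g : PseudoRiemannianMetric I ∞ E (TangentSpace I : M → Type _))

/-- **Smooth approximation of compactly supported Lipschitz functions with gradient control**
(Azagra–Ferrera–López-Mesas–Rangel 2007, Thm. 1, for `f` of compact support on a possibly
non-compact manifold). Let `g` be a smooth Riemannian metric on a Hausdorff σ-compact manifold,
`F : M → ℝ` continuous with compact support and `|F x - F y| ≤ L d_g(x, y)` (`L ≥ 0`), and `W` an
open set containing `tsupport F`. Then for every `ε > 0` there is a `C^∞` function `χ : M → ℝ`
with compact support contained in `W`, `|χ - F| < ε` and `|∇χ|²_g ≤ (L + ε)²` everywhere.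
Construction: finitely many relatively compact chart domains `Uᵢ ⊆ V` covering `tsupport F`
(`V` a relatively compact neighbourhood of `tsupport F` with `closure V ⊆ W`) together with
`U₀ = (tsupport F)ᶜ`; a smooth partition of unity `{ρᵢ}` subordinate to this finite cover; chart
mollifications `Φᵢ` on `tsupport ρᵢ` (`exists_contDiff_chart_smoothing_of_bounded`) and `Φ₀ = 0`;
`χ = ∑ᵢ ρᵢ · (Φᵢ ∘ φᵢ)`, estimated as in the compact case (`∑ dρᵢ = 0`; the `U₀`-terms vanish
identically since `F = 0` on `tsupport ρ₀`). [cite: AzagraEtAl2007, Thm. 1] -/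
theorem exists_contMDiff_approx_of_hasCompactSupport (hg : g.IsRiemannian) {F : M → ℝ}
    (hFc : Continuous F) (hFs : HasCompactSupport F) {L : ℝ} (hL : 0 ≤ L)
    (hF : ∀ x y, ENNReal.ofReal |F x - F y| ≤ ENNReal.ofReal L * g.edist hg x y)
    {W : Set M} (hW : IsOpen W) (hFW : tsupport F ⊆ W) {ε : ℝ} (hε : 0 < ε) :
    ∃ χ : M → ℝ, ContMDiff I 𝓘(ℝ, ℝ) ∞ χ ∧ HasCompactSupport χ ∧ tsupport χ ⊆ W ∧
      (∀ x, |χ x - F x| < ε) ∧ ∀ x, g.gradSq χ x ≤ (L + ε) ^ 2 := by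
  classical
  haveI : LocallyCompactSpace M := Manifold.locallyCompact_of_finiteDimensional I
  -- Step 0: the compact support `K₀`, a relatively compact `V` with `K₀ ⊆ V`, `closure V ⊆ W`
  set K₀ : Set M := tsupport F with hK₀
  have hK₀c : IsCompact K₀ := hFs
  obtain ⟨V, hVo, hK₀V, hVW, hVc⟩ := exists_open_between_and_isCompact_closure hK₀c hW hFW
  have hFb : ∃ C, ∀ x, ‖F x‖ ≤ C := by
    obtain ⟨C, hC⟩ := hFs.exists_bound_of_continuous hFc
    exact ⟨C, hC⟩
  have hF0 : ∀ x ∉ K₀, F x = 0 := fun x hx ↦ image_eq_zero_of_notMem_tsupport hx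
  -- Step 1: a finite cover of `K₀` by relatively compact chart domains, plus `K₀ᶜ`
  obtain ⟨t, ht⟩ := hK₀c.elim_finite_subcover (fun x : M ↦ (chartAt H x).source ∩ V)
    (fun x ↦ (chartAt H x).open_source.inter hVo)
    (fun p hp ↦ mem_iUnion.2 ⟨p, mem_chart_source H p, hK₀V hp⟩)
  set U : Option t → Set M := fun i ↦ Option.casesOn i K₀ᶜ
    (fun j ↦ (chartAt H (j : M)).source ∩ V) with hU
  have hUo : ∀ i, IsOpen (U i) := by
    rintro (_ | j)
    · exact (isClosed_tsupport F).isOpen_compl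
    · exact (chartAt H (j : M)).open_source.inter hVo
  have hUcov : univ ⊆ ⋃ i, U i := by
    intro p _
    by_cases hp : p ∈ K₀
    · obtain ⟨j, hj, hpj⟩ := mem_iUnion₂.1 (ht hp)
      exact mem_iUnion.2 ⟨some ⟨j, hj⟩, hpj⟩
    · exact mem_iUnion.2 ⟨none, hp⟩
  obtain ⟨ρ, hρ⟩ := SmoothPartitionOfUnity.exists_isSubordinate I isClosed_univ U hUo hUcov
  have hsum : ∀ p, ∑ i, ρ i p = 1 := fun p ↦ by
    rw [← finsum_eq_sum_of_fintype]
    exact ρ.sum_eq_one (mem_univ p)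
  have hρs : ∀ i, ContMDiff I 𝓘(ℝ, ℝ) ∞ (ρ i) := fun i ↦ (ρ i).contMDiff
  have hρd : ∀ i x, MDifferentiableAt I 𝓘(ℝ, ℝ) (ρ i) x := fun i x ↦
    ((hρs i) x).mdifferentiableAt (by simp)
  -- supports of the chart terms are compact and inside the chart domains and `V`
  have hρV : ∀ j : t, tsupport (ρ (some j)) ⊆ V := fun j ↦ (hρ (some j)).trans inter_subset_right
  have hρsrc : ∀ j : t, tsupport (ρ (some j)) ⊆ (chartAt H (j : M)).source := fun j ↦
    (hρ (some j)).trans inter_subset_left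
  have hρc : ∀ j : t, IsCompact (tsupport (ρ (some j))) := fun j ↦
    hVc.of_isClosed_subset (isClosed_tsupport _) ((hρV j).trans subset_closure)
  have hρ0 : tsupport (ρ none) ⊆ K₀ᶜ := hρ none
  -- Step 2: bounds for the differentials of the chart terms `ρ (some j)`
  have hDi : ∀ j : t, ∃ D : ℝ, 0 ≤ D ∧ ∀ x (v : TangentSpace I x),
      |mvfderiv I (ρ (some j)) x v| ≤ D * Real.sqrt (g.val x v v) := by
    intro j
    have hc : Continuous (g.gradSq (ρ (some j))) :=
      continuous_innerDual_mvfderiv g ((hρs _).of_le (by norm_num)) ((hρs _).of_le (by norm_num))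
    obtain ⟨B, hB⟩ := (hρc j).exists_bound_of_continuousOn hc.continuousOn
    refine ⟨Real.sqrt (max B 0), Real.sqrt_nonneg _, fun x v ↦ ?_⟩
    by_cases hx : x ∈ tsupport (ρ (some j))
    · refine (abs_mvfderiv_le_sqrt_gradSq_mul_sqrt g hg (ρ (some j)) x v).trans ?_
      gcongr
      exact (le_abs_self _).trans
        ((by simpa [Real.norm_eq_abs] using hB x hx : |g.gradSq (ρ (some j)) x| ≤ B).trans
          (le_max_left _ _))
    · rw [mvfderiv_eq_zero_of_notMem_tsupport hx]
      simp only [zero_apply, abs_zero]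
      positivity
  choose D hD0 hD using hDi
  set Dt : ℝ := ∑ j, D j with hDt
  have hDt0 : 0 ≤ Dt := Finset.sum_nonneg (fun j _ ↦ hD0 j)
  -- accuracies
  set η₁ : ℝ := ε / (2 * (Dt + 1)) with hη₁
  have hη₁pos : 0 < η₁ := by positivity
  have hη₁D : η₁ * Dt ≤ ε / 2 := by
    rw [hη₁, div_mul_eq_mul_div, div_le_div_iff₀ (by positivity) (by positivity)]
    nlinarith
  have hη₁ε : η₁ < ε := by
    rw [hη₁, div_lt_iff₀ (by positivity)]
    nlinarith
  set η₂ : ℝ := ε / (2 * (L + 1)) with hη₂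
  have hη₂pos : 0 < η₂ := by positivity
  have hη₂L : L * η₂ ≤ ε / 2 := by
    rw [hη₂, mul_div_assoc', div_le_div_iff₀ (by positivity) (by positivity)]
    nlinarith
  -- Step 3: chart-local smoothings on the supports of the `ρ (some j)`
  have hchart : ∀ j : t, ∃ Φ : E → ℝ, ContDiff ℝ ∞ Φ ∧
      (∀ x ∈ tsupport (ρ (some j)), |Φ (extChartAt I (j : M) x) - F x| ≤ η₁) ∧
      ∀ x ∈ tsupport (ρ (some j)), ∀ u : TangentSpace I x,
        |mvfderiv I (Φ ∘ extChartAt I (j : M)) x u| ≤ L * (1 + η₂) * Real.sqrt (g.val x u u) :=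
    fun j ↦ exists_contDiff_chart_smoothing_of_bounded g hg (j : M) hFc hFb hL hF (hρc j)
      (hρsrc j) hη₁pos hη₂pos
  choose Φ hΦs hΦF hΦD using hchart
  -- Step 4: the approximation `χ = ∑ ρᵢ · Ψᵢ`, `Ψ₀ = 0`, `Ψⱼ = Φⱼ ∘ φⱼ`
  set Ψ : Option t → M → ℝ := fun i ↦ Option.casesOn i (fun _ ↦ 0)
    (fun j x ↦ Φ j (extChartAt I (j : M) x)) with hΨ
  have hΨ0 : Ψ none = fun _ ↦ 0 := rfl
  have hΨj : ∀ j : t, Ψ (some j) = fun x ↦ Φ j (extChartAt I (j : M) x) := fun j ↦ rfl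
  have hΨs : ∀ i, ∀ x ∈ tsupport (ρ i), ContMDiffAt I 𝓘(ℝ, ℝ) ∞ (Ψ i) x := by
    rintro (_ | j) x hx
    · exact contMDiffAt_const
    · exact (hΦs j).contDiffAt.comp_contMDiffAt (contMDiffAt_extChartAt' (hρsrc j hx))
  -- closeness of `Ψ i` to `F` on `tsupport (ρ i)`
  have hΨF : ∀ i, ∀ x ∈ tsupport (ρ i), |Ψ i x - F x| ≤ η₁ := by
    rintro (_ | j) x hx
    · rw [hΨ0, hF0 x (hρ0 hx)]
      simp only [sub_zero, abs_zero]
      exact hη₁pos.le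
    · exact hΦF j x hx
  have hterm : ∀ i, ContMDiff I 𝓘(ℝ, ℝ) ∞ (fun x ↦ ρ i x * Ψ i x) := fun i ↦
    ρ.contMDiff_smul (hΨs i)
  have htermd : ∀ i x, MDifferentiableAt I 𝓘(ℝ, ℝ) (fun x ↦ ρ i x * Ψ i x) x := fun i x ↦
    ((hterm i) x).mdifferentiableAt (by simp)
  -- the support of `χ`
  set S : Set M := ⋃ j : t, tsupport (ρ (some j)) with hS
  have hSc : IsCompact S := isCompact_iUnion fun j ↦ hρc j
  have hSV : S ⊆ V := iUnion_subset fun j ↦ hρV j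
  have hχS : ∀ x ∉ S, (∑ i, ρ i x * Ψ i x) = 0 := by
    intro x hx
    rw [Fintype.sum_option]
    have h1 : ∀ j : t, ρ (some j) x * Ψ (some j) x = 0 := fun j ↦ by
      have hxj : x ∉ tsupport (ρ (some j)) := fun h ↦ hx (mem_iUnion.2 ⟨j, h⟩)
      rw [image_eq_zero_of_notMem_tsupport hxj, zero_mul]
    simp [hΨ0, h1]
  have htsupp : tsupport (fun x ↦ ∑ i, ρ i x * Ψ i x) ⊆ S := by
    rw [tsupport]
    refine closure_minimal (fun x hx ↦ ?_) hSc.isClosed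
    by_contra hxS
    exact hx (hχS x hxS)
  refine ⟨fun x ↦ ∑ i, ρ i x * Ψ i x, contMDiff_finsetSum (fun i _ ↦ hterm i),
    hSc.of_isClosed_subset (isClosed_tsupport _) htsupp,
    htsupp.trans (hSV.trans (subset_closure.trans hVW)), fun x ↦ ?_, fun x ↦ ?_⟩
  · -- closeness
    have heq : (∑ i, ρ i x * Ψ i x) - F x = ∑ i, ρ i x * (Ψ i x - F x) := by
      simp only [mul_sub, Finset.sum_sub_distrib, ← Finset.sum_mul, hsum x, one_mul]
    rw [heq]
    calc |∑ i, ρ i x * (Ψ i x - F x)| ≤ ∑ i, |ρ i x * (Ψ i x - F x)| :=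
          Finset.abs_sum_le_sum_abs _ _
      _ ≤ ∑ i, ρ i x * η₁ := Finset.sum_le_sum (fun i _ ↦ ?_)
      _ = η₁ := by rw [← Finset.sum_mul, hsum x, one_mul]
      _ < ε := hη₁ε
    rw [abs_mul, abs_of_nonneg (ρ.nonneg i x)]
    by_cases hx : x ∈ tsupport (ρ i)
    · exact mul_le_mul_of_nonneg_left (hΨF i x hx) (ρ.nonneg i x)
    · rw [image_eq_zero_of_notMem_tsupport hx, zero_mul, zero_mul]
  · -- gradient: `|dχ(v)| ≤ (L(1+η₂) + η₁ Dt) |v| ≤ (L + ε) |v|`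
    refine gradSq_le_sq_of_forall_abs_mvfderiv_le g hg (by positivity) (fun v ↦ ?_)
    set nv : ℝ := Real.sqrt (g.val x v v) with hnv
    have hnv0 : 0 ≤ nv := Real.sqrt_nonneg _
    -- differential of the sum
    have hsumd := (mvfderiv_finset_sum (I := I) Finset.univ (fun i _ ↦ htermd i x)).2
    have hχd : mvfderiv I (fun x ↦ ∑ i, ρ i x * Ψ i x) x v =
        ∑ i, mvfderiv I (fun x ↦ ρ i x * Ψ i x) x v := by
      rw [hsumd]
      simp only [FunLike.coe_sum, Finset.sum_apply]
    -- per-term product rule (or vanishing off the support)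
    set A : Option t → ℝ := fun i ↦ if x ∈ tsupport (ρ i) then mvfderiv I (Ψ i) x v else 0
      with hA
    have hT : ∀ i, mvfderiv I (fun x ↦ ρ i x * Ψ i x) x v =
        ρ i x * A i + Ψ i x * mvfderiv I (ρ i) x v := by
      intro i
      by_cases hx : x ∈ tsupport (ρ i)
      · simp only [hA, if_pos hx]
        have hΨd : MDifferentiableAt I 𝓘(ℝ, ℝ) (Ψ i) x := (hΨs i x hx).mdifferentiableAt (by simp)
        have h := mvfderiv_mul (hρd i x) hΨd
        rw [show (fun x ↦ ρ i x * Ψ i x) = (⇑(ρ i) * Ψ i) from rfl, h]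
        simp only [add_apply, FunLike.coe_smul, Pi.smul_apply, smul_eq_mul]
      · simp only [hA, if_neg hx, mul_zero, zero_add]
        have h1 : mvfderiv I (fun x ↦ ρ i x * Ψ i x) x = 0 :=
          mvfderiv_eq_zero_of_notMem_tsupport (fun h ↦ hx (tsupport_mul_subset_left h))
        have h2 : mvfderiv I (ρ i) x = 0 := mvfderiv_eq_zero_of_notMem_tsupport hx
        simp [h1, h2]
    have hAle : ∀ i, |A i| ≤ L * (1 + η₂) * nv := by
      rintro (_ | j)
      · have : A none = 0 := by
          simp only [hA]
          split_ifs
          · rw [hΨ0, mvfderiv_const]; rfl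
          · rfl
        rw [this, abs_zero]; positivity
      · by_cases hx : x ∈ tsupport (ρ (some j))
        · simp only [hA, if_pos hx]; exact hΦD j x hx v
        · simp only [hA, if_neg hx, abs_zero]; positivity
    -- `∑ dρᵢ = 0`
    have hρsum0 : ∑ i, mvfderiv I (ρ i) x v = 0 := by
      have h := (mvfderiv_finset_sum (I := I) Finset.univ (fun i _ ↦ hρd i x)).2
      have hconst : (fun x ↦ ∑ i ∈ Finset.univ, ρ i x) = fun _ ↦ (1 : ℝ) := funext hsum
      rw [hconst, mvfderiv_const] at h
      have := congr($h v)
      simpa [FunLike.coe_sum, Finset.sum_apply] using this.symm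
    -- the error terms: `D₀ = 0` works for `i = none` since `F = Ψ₀ = 0` on `tsupport ρ₀`
    set D' : Option t → ℝ := fun i ↦ Option.casesOn i 0 (fun j ↦ D j) with hD'
    have hD'0 : ∀ i, 0 ≤ D' i := by
      rintro (_ | j)
      · exact le_rfl
      · exact hD0 j
    have hD't : ∑ i, D' i = Dt := by
      rw [Fintype.sum_option]
      simp [hD', hDt]
    have hBle : ∀ i, |(Ψ i x - F x) * mvfderiv I (ρ i) x v| ≤ η₁ * (D' i * nv) := by
      rintro (_ | j)
      · have h0 : (Ψ none x - F x) * mvfderiv I (ρ none) x v = 0 := by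
          by_cases hx : x ∈ tsupport (ρ none)
          · rw [hΨ0, hF0 x (hρ0 hx)]; simp
          · rw [mvfderiv_eq_zero_of_notMem_tsupport hx]; simp
        rw [h0, abs_zero]
        exact mul_nonneg hη₁pos.le (mul_nonneg (hD'0 none) hnv0)
      · by_cases hx : x ∈ tsupport (ρ (some j))
        · rw [abs_mul]
          exact mul_le_mul (hΦF j x hx) (hD j x v) (abs_nonneg _) hη₁pos.le
        · rw [mvfderiv_eq_zero_of_notMem_tsupport hx]
          simp only [zero_apply, mul_zero, abs_zero]
          exact mul_nonneg hη₁pos.le (mul_nonneg (hD'0 (some j)) hnv0)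
    -- assemble
    have hsplit : ∑ i, mvfderiv I (fun x ↦ ρ i x * Ψ i x) x v =
        ∑ i, ρ i x * A i + ∑ i, (Ψ i x - F x) * mvfderiv I (ρ i) x v := by
      simp only [hT, Finset.sum_add_distrib, sub_mul, Finset.sum_sub_distrib, ← Finset.mul_sum,
        hρsum0, mul_zero, sub_zero]
    rw [hχd, hsplit]
    calc |∑ i, ρ i x * A i + ∑ i, (Ψ i x - F x) * mvfderiv I (ρ i) x v|
        ≤ |∑ i, ρ i x * A i| + |∑ i, (Ψ i x - F x) * mvfderiv I (ρ i) x v| := abs_add_le _ _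
      _ ≤ ∑ i, |ρ i x * A i| + ∑ i, |(Ψ i x - F x) * mvfderiv I (ρ i) x v| :=
          add_le_add (Finset.abs_sum_le_sum_abs _ _) (Finset.abs_sum_le_sum_abs _ _)
      _ ≤ ∑ i, ρ i x * (L * (1 + η₂) * nv) + ∑ i, η₁ * (D' i * nv) := by
          gcongr with i _ i _
          · rw [abs_mul, abs_of_nonneg (ρ.nonneg i x)]
            exact mul_le_mul_of_nonneg_left (hAle i) (ρ.nonneg i x)
          · exact hBle i
      _ = (L * (1 + η₂) + η₁ * Dt) * nv := by
          rw [← Finset.sum_mul, hsum x, one_mul, ← Finset.mul_sum, ← Finset.sum_mul, hD't]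
          ring
      _ ≤ (L + ε) * nv := by
          apply mul_le_mul_of_nonneg_right _ hnv0
          nlinarith

end Global

end Literature.Geometry.Riemannian

end
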